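import Literature.NumberTheory.EllipticCurves.QuadraticTwistTateFormProofs
import Literature.NumberTheory.EllipticCurves.QuadraticTwistIntegralModel
import Literature.NumberTheory.DiophantineGeometry.LocalReductionHasMultiplicativeReductionAtProofs
import Literature.NumberTheory.DiophantineGeometry.LocalReductionIsIntegralAtProofs
import Literature.NumberTheory.DiophantineGeometry.LocalReductionProofs
import HarnessLib

/-!
# Route `TamagawaTwistDictionary`, crux `TamagawaTwistPayoff` (stmt-ABC-24114) — helper:
# an explicit SPLIT multiplicative model at a potentially multiplicative place

For the twist dictionary «Conj 1.14 ⟹ sub-exponential Szpiro» one needs, at every place `v` with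
`ord_v(j_E) < 0`, a curve with the same `j` and SPLIT multiplicative reduction at `v` (so that
Tate's `c_v = ord_v(Δ_min) = −ord_v(j)` can be read inside a Tamagawa product). This file supplies
it WITHOUT Hensel / `γ = −c₄/c₆` bookkeeping:

* `hasSplitMultiplicativeReductionAt_of_tateShape` — over the fraction field `K` of any Dedekind
  domain: an elliptic Weierstrass equation with `a₁ = 1`, `a₃ = 0` and `a₂, a₄, a₆ ∈ 𝔪_v` is
  `v`-integral, minimal (`c₄ ≡ 1`), multiplicative (`Δ ≡ 0`), and Mathlib's node polynomial
  `c₄T² + a₁c₄T − (54b₆ − 3b₂b₄ + a₂c₄)` reduces to `T² + T = T(T+1)`, which splits — exactly the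
  computation of Silverman, *ATAEC*, proof of Thm. V.5.3 (b) (i) ⇒ (iii) («the reduced curve is
  `y² + xy = x³`, which clearly has split multiplicative reduction», PDF p. 408; tree template
  `TateCurve.tateCurve_hasSplitMultiplicativeReduction`), transported to the chosen local minimal
  model by `hasSplitMultiplicativeReduction_iff_of_isMinimal_of_eq_smul` (AEC VII.1.3 (b)).
* `hasSplitMultiplicativeReductionAt_twistModel_tateFormOfJ` — for `E/K` elliptic (char. 0 not
  needed) and a place `v` with `ord_v(j_E) < 0`, the integral twist model
  `(tateFormOfJ j_E).twistModel k = y² + xy = x³ + k x² + u²a₄ x + u³a₆` (`u = 4k + 1`) of the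
  Tate form `y² + xy = x³ − 36x/(j−1728) − 1/(j−1728)` by ANY `k ∈ 𝔪_v` has SPLIT multiplicative
  reduction at `v` (in every residue characteristic, `2` and `3` included). Choosing `k` so that
  `u` lies in a prescribed square class is how the payoff makes a small twist of `E` split at `v`.

HONESTY: local bookkeeping for the line «Conj 1.14 ⟹ A1′»; NOT abc, NOT A-PS, and by itself not
even the payoff. No `sorry`, no new axiom, no `def`.

References: J. H. Silverman, *Advanced Topics in the Arithmetic of Elliptic Curves* (1994),
Thm. V.5.3, Lemma V.5.1; *The Arithmetic of Elliptic Curves* (2009), VII.1 Remark 1.1,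
Prop. VII.1.3 (b), VII.5 Prop. 5.1 (b).
-/

noncomputable section

-- `Summit.<Summit>.<Problem>` is the mandated summit-side namespace (CONVENTIONS §2); for the
-- single-conjunct summit `ABC` the two coincide, so the duplicate `ABC.ABC` is deliberate.
set_option linter.dupNamespace false

namespace Summit.ABC.ABC.Theorems.TamagawaTwistPayoffLine

open IsDedekindDomain WeierstrassCurve Literature.NumberTheory.EllipticCurves Polynomial

variable {A : Type*} [CommRing A] [IsDedekindDomain A] {K : Type*} [Field K] [Algebra A K]
  [IsFractionRing A K] (v : HeightOneSpectrum A)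

/-- **An equation of Tate shape has split multiplicative reduction.** Let `W / K` be an elliptic
Weierstrass equation with `a₁ = 1`, `a₃ = 0` and `ord_v(a₂), ord_v(a₄), ord_v(a₆) > 0`. Then `W`
has SPLIT multiplicative reduction at `v`: the equation is `v`-integral with `c₄ ≡ 1`, `Δ ≡ 0`
(so it is minimal with multiplicative reduction, Silverman AEC VII.1 Remark 1.1 and VII.5.1 (b)),
and the node polynomial of Mathlib's `HasSplitMultiplicativeReduction` reduces to `T (T + 1)`
(ATAEC, proof of Thm. V.5.3 (b), (i) ⇒ (iii)); the property passes to the chosen local minimal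
model (AEC VII.1.3 (b)). [cite: SilvermanATAEC1994, Thm. V.5.3 (b) (proof, PDF p. 408)] -/
theorem hasSplitMultiplicativeReductionAt_of_tateShape (W : WeierstrassCurve K) [W.IsElliptic]
    (h1 : W.a₁ = 1) (h3 : W.a₃ = 0) (h2 : v.valuation K W.a₂ < 1)
    (h4 : v.valuation K W.a₄ < 1) (h6 : v.valuation K W.a₆ < 1) :
    W.HasSplitMultiplicativeReductionAt v := by
  set O := v.adicCompletionIntegers K with hO
  set X := W.baseChange (v.adicCompletion K) with hX
  -- integrality
  have hint : W.IsIntegralAt v := by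
    rw [isIntegralAt_iff_valuation_le_one]
    refine ⟨by rw [h1, map_one], h2.le, by rw [h3, map_zero]; exact zero_le_one, h4.le, h6.le⟩
  haveI hXint : X.IsIntegral O := hint
  haveI : X.IsElliptic := by rw [hX, WeierstrassCurve.baseChange]; infer_instance
  set I := X.integralModel O with hI
  set φ := IsLocalRing.residue O with hφ
  -- the coefficients of the integral model
  have hXa : X.a₁ = 1 ∧ X.a₂ = (W.a₂ : v.adicCompletion K) ∧ X.a₃ = 0 ∧
      X.a₄ = (W.a₄ : v.adicCompletion K) ∧ X.a₆ = (W.a₆ : v.adicCompletion K) := by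
    simp only [hX, WeierstrassCurve.baseChange, map_a₁, map_a₂, map_a₃, map_a₄, map_a₆, h1, h3,
      map_one, map_zero]
    exact ⟨trivial, rfl, trivial, rfl, rfl⟩
  have hmem : ∀ {r : O} {k : K}, algebraMap O (v.adicCompletion K) r = (k : v.adicCompletion K) →
      v.valuation K k < 1 → r ∈ IsLocalRing.maximalIdeal O := by
    intro r k hr hk
    have h : (IsDiscreteValuationRing.maximalIdeal O).valuation (v.adicCompletion K)
        (algebraMap O (v.adicCompletion K) r) < 1 := by
      rw [hr]; exact (valuation_maximalIdeal_adicCompletion_lt_one_iff v k).mpr hk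
    exact (HeightOneSpectrum.valuation_lt_one_iff_mem _ r).mp h
  have hI1 : I.a₁ = 1 := by
    apply IsFractionRing.injective O (v.adicCompletion K)
    rw [hI, integralModel_a₁_eq, map_one, hXa.1]
  have hI3 : I.a₃ = 0 := by
    apply IsFractionRing.injective O (v.adicCompletion K)
    rw [hI, integralModel_a₃_eq, map_zero, hXa.2.2.1]
  have hI2 : I.a₂ ∈ IsLocalRing.maximalIdeal O :=
    hmem (by rw [hI, integralModel_a₂_eq, hXa.2.1]) h2
  have hI4 : I.a₄ ∈ IsLocalRing.maximalIdeal O :=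
    hmem (by rw [hI, integralModel_a₄_eq, hXa.2.2.2.1]) h4
  have hI6 : I.a₆ ∈ IsLocalRing.maximalIdeal O :=
    hmem (by rw [hI, integralModel_a₆_eq, hXa.2.2.2.2]) h6
  have r1 : φ I.a₁ = 1 := by rw [hI1, map_one]
  have r2 : φ I.a₂ = 0 := (IsLocalRing.residue_eq_zero_iff _).mpr hI2
  have r3 : φ I.a₃ = 0 := by rw [hI3, map_zero]
  have r4 : φ I.a₄ = 0 := (IsLocalRing.residue_eq_zero_iff _).mpr hI4
  have r6 : φ I.a₆ = 0 := (IsLocalRing.residue_eq_zero_iff _).mpr hI6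
  -- the reduced invariants: `b₂ ≡ 1`, `b₄ ≡ b₆ ≡ b₈ ≡ 0`, `c₄ ≡ 1`, `Δ ≡ 0`
  have rb2 : φ I.b₂ = 1 := by
    simp only [WeierstrassCurve.b₂, map_add, map_mul, map_pow, map_ofNat, r1, r2]; ring
  have rb4 : φ I.b₄ = 0 := by
    simp only [WeierstrassCurve.b₄, map_add, map_mul, map_ofNat, r1, r3, r4]; ring
  have rb6 : φ I.b₆ = 0 := by
    simp only [WeierstrassCurve.b₆, map_add, map_mul, map_pow, map_ofNat, r3, r6]; ring
  have rb8 : φ I.b₈ = 0 := by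
    simp only [WeierstrassCurve.b₈, map_add, map_sub, map_mul, map_pow, map_ofNat, r1, r2, r3, r4,
      r6]; ring
  have rc4 : φ I.c₄ = 1 := by
    simp only [WeierstrassCurve.c₄, map_sub, map_mul, map_pow, map_ofNat, rb2, rb4]; ring
  have rΔ : φ I.Δ = 0 := by
    simp only [WeierstrassCurve.Δ, map_add, map_sub, map_mul, map_pow, map_ofNat, map_neg, rb2, rb4,
      rb6, rb8]; ring
  -- `c₄` is a unit and `Δ ∈ 𝔪`, read in Mathlib's valuation on `K_v`
  have hc₄O : I.c₄ ∉ IsLocalRing.maximalIdeal O := fun h => by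
    rw [(IsLocalRing.residue_eq_zero_iff _).mpr h] at rc4; exact zero_ne_one rc4
  have hΔO : I.Δ ∈ IsLocalRing.maximalIdeal O := (IsLocalRing.residue_eq_zero_iff _).mp rΔ
  have hc₄X : (IsDiscreteValuationRing.maximalIdeal O).valuation (v.adicCompletion K) X.c₄ = 1 := by
    rw [← integralModel_c₄_eq O X]
    exact (HeightOneSpectrum.valuation_eq_one_iff_notMem _).mpr hc₄O
  have hΔX : (IsDiscreteValuationRing.maximalIdeal O).valuation (v.adicCompletion K) X.Δ < 1 := by
    rw [← integralModel_Δ_eq O X]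
    exact (HeightOneSpectrum.valuation_lt_one_iff_mem _ _).mpr hΔO
  -- minimality (`ord_v(c₄) = 0 < 4`, AEC VII.1 Remark 1.1)
  have hc₄K : v.valuation K W.c₄ = 1 := by
    have h : X.c₄ = (W.c₄ : v.adicCompletion K) := by
      rw [hX, WeierstrassCurve.baseChange, map_c₄]; rfl
    rw [h] at hc₄X
    exact (valuation_maximalIdeal_adicCompletion_eq_one_iff v W.c₄).mp hc₄X
  haveI hmin : X.IsMinimal O :=
    isMinimalAt_of_lt_valuation_c₄ hint
      (by rw [hc₄K, ← WithZero.exp_zero]; exact WithZero.exp_lt_exp.mpr (by norm_num))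
  -- split multiplicative reduction of `X`
  have hmult : X.HasMultiplicativeReduction O := by
    rw [hasMultiplicativeReduction_iff]
    exact ⟨hmin, hΔX, hc₄X⟩
  have hpoly : Polynomial.map (algebraMap O (IsLocalRing.ResidueField O))
      (C I.c₄ * Polynomial.X ^ 2 + C (I.a₁ * I.c₄) * Polynomial.X -
        C (54 * I.b₆ - 3 * I.b₂ * I.b₄ + I.a₂ * I.c₄)) =
      Polynomial.X * (Polynomial.X + C 1) := by
    have e : algebraMap O (IsLocalRing.ResidueField O) = φ := rfl
    simp only [Polynomial.map_sub, Polynomial.map_add, Polynomial.map_mul, Polynomial.map_pow,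
      map_C, map_X, e, map_mul, map_sub, map_add, map_ofNat, rc4, r1, r2, rb2, rb4, rb6, map_one,
      map_zero, mul_zero, sub_zero, add_zero, one_mul, mul_one]
    ring
  have hsplitX : X.HasSplitMultiplicativeReduction O := by
    rw [hasSplitMultiplicativeReduction_iff]
    refine ⟨hmult, ?_⟩
    rw [← hI, hpoly]
    exact Polynomial.Splits.X.mul (Polynomial.Splits.X_add_C 1)
  -- transport to the chosen local minimal model
  obtain ⟨E, hE⟩ : ∃ E : VariableChange (v.adicCompletion K), W.localMinimalModel v = E • X :=
    ⟨_, rfl⟩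
  unfold HasSplitMultiplicativeReductionAt
  exact (hasSplitMultiplicativeReduction_iff_of_isMinimal_of_eq_smul O hE X.isUnit_Δ.ne_zero).mpr
    hsplitX

/-- `4k + 1` is a `v`-adic unit when `k ∈ 𝔪_v` (since `|4|_v ≤ 1`). [folklore] -/
theorem valuation_four_mul_add_one_eq_one {k : K} (hk : v.valuation K k < 1) :
    v.valuation K (4 * k + 1) = 1 := by
  have h4 : v.valuation K (4 : K) ≤ 1 := by
    rw [show (4 : K) = algebraMap A K 4 from (map_ofNat _ _).symm]; exact v.valuation_le_one _
  have h4k : v.valuation K (4 * k) < 1 := by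
    rw [map_mul]
    calc v.valuation K 4 * v.valuation K k ≤ 1 * v.valuation K k := by gcongr
      _ = v.valuation K k := one_mul _
      _ < 1 := hk
  rw [add_comm]
  exact Valuation.map_one_add_of_lt _ h4k

/-- **The twist model of the Tate form by `k ∈ 𝔪_v` has SPLIT multiplicative reduction at `v`.**
For `E/K` elliptic and a finite place `v` with `ord_v(j_E) < 0` (`1 < v.valuation K E.j`), and any
`k ∈ K` with `ord_v(k) > 0`, the equation `(tateFormOfJ j_E).twistModel k`, i.e.
`y² + xy = x³ + k x² + u² a₄ x + u³ a₆` with `u = 4k + 1`, `a₄ = −36/(j−1728)`, `a₆ = −1/(j−1728)`,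
is elliptic with `j = j_E` and has split multiplicative reduction at `v` (any residue
characteristic): `a₁ = 1`, `a₃ = 0`, and `a₂ = k`, `a₄`, `a₆` lie in `𝔪_v`
(`ord_v(j − 1728) = ord_v(j) < 0`, Silverman ATAEC V.5 Lemma 5.1). It is a model of the quadratic
twist `T^{(u)}` of the Tate form `T` (`exists_variableChange_twistModel_eq_quadraticTwist`).
[cite: SilvermanATAEC1994, V.5 Lemma 5.1 and Thm. V.5.3 (b)] -/
theorem hasSplitMultiplicativeReductionAt_twistModel_tateFormOfJ (W : WeierstrassCurve K)
    [W.IsElliptic] (hj : 1 < v.valuation K W.j) {k : K} (hk : v.valuation K k < 1)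
    [((tateFormOfJ W.j).twistModel k).IsElliptic] :
    ((tateFormOfJ W.j).twistModel k).HasSplitMultiplicativeReductionAt v := by
  set ν := v.valuation K with hν
  obtain ⟨hj0, hj1728, hsub⟩ := W.j_ne_and_valuation_j_sub_eq_of_one_lt_valuation_j v hj
  have hpos : 0 < ν W.j := lt_trans zero_lt_one hj
  have hu : ν (4 * k + 1) = 1 := valuation_four_mul_add_one_eq_one v hk
  have h36 : ν (36 : K) ≤ 1 := by
    rw [show (36 : K) = algebraMap A K 36 from (map_ofNat _ _).symm]; exact v.valuation_le_one _
  have ha₄ : ν (tateFormOfJ W.j).a₄ < 1 := by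
    rw [tateFormOfJ_a₄, map_div₀, Valuation.map_neg, hsub, div_lt_one₀ hpos]
    exact lt_of_le_of_lt h36 hj
  have ha₆ : ν (tateFormOfJ W.j).a₆ < 1 := by
    rw [tateFormOfJ_a₆, map_div₀, Valuation.map_neg, map_one, hsub, div_lt_one₀ hpos]
    exact hj
  refine hasSplitMultiplicativeReductionAt_of_tateShape v _ ?_ ?_ ?_ ?_ ?_
  · rw [twistModel_a₁, tateFormOfJ_a₁]
  · rw [twistModel_a₃, tateFormOfJ_a₃, mul_zero]
  · rw [twistModel_a₂, tateFormOfJ_a₂, tateFormOfJ_a₁, mul_zero, zero_add, one_pow, mul_one]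
    exact hk
  · rw [twistModel_a₄, tateFormOfJ_a₁, tateFormOfJ_a₃, mul_zero, add_zero, map_mul,
      map_pow, hu, one_pow, one_mul]
    exact ha₄
  · rw [twistModel_a₆, tateFormOfJ_a₃, zero_pow two_ne_zero, mul_zero, add_zero, map_mul, map_pow,
      hu, one_pow, one_mul]
    exact ha₆

/-- The twist model of the Tate form by `k ∈ 𝔪_v` is an elliptic curve (`Δ = u⁶ Δ(T) ≠ 0`,
`u = 4k + 1` a `v`-unit, `T` elliptic as `j ≠ 0, 1728`). [folklore] -/
theorem isElliptic_twistModel_tateFormOfJ (W : WeierstrassCurve K) [W.IsElliptic]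
    (hj : 1 < v.valuation K W.j) {k : K} (hk : v.valuation K k < 1) :
    ((tateFormOfJ W.j).twistModel k).IsElliptic := by
  obtain ⟨hj0, hj1728, -⟩ := W.j_ne_and_valuation_j_sub_eq_of_one_lt_valuation_j v hj
  haveI := isElliptic_tateFormOfJ hj0 hj1728
  have hu : v.valuation K (4 * k + 1) = 1 := valuation_four_mul_add_one_eq_one v hk
  have hu0 : (4 * k + 1) ≠ 0 := fun h => by rw [h, map_zero] at hu; exact zero_ne_one hu
  exact ⟨by rw [twistModel_Δ]; exact (IsUnit.mk0 _ (pow_ne_zero 6 hu0)).mul (tateFormOfJ W.j).isUnit_Δ⟩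

/-- The twist model has the same `j`-invariant (`c₄ ↦ u²c₄`, `Δ ↦ u⁶Δ`, `u = 4k + 1`), over any
field. [folklore] -/
theorem j_twistModel (W₀ : WeierstrassCurve K) [W₀.IsElliptic] (k : K)
    [(W₀.twistModel k).IsElliptic] : (W₀.twistModel k).j = W₀.j := by
  have hu0 : (4 * k + 1) ≠ 0 := by
    intro h
    have hΔ := (W₀.twistModel k).isUnit_Δ.ne_zero
    rw [twistModel_Δ, h, zero_pow (by norm_num), zero_mul] at hΔ
    exact hΔ rfl
  have hΔ0 : W₀.Δ ≠ 0 := W₀.isUnit_Δ.ne_zero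
  unfold WeierstrassCurve.j
  rw [Units.val_inv_eq_inv_val, Units.val_inv_eq_inv_val, WeierstrassCurve.coe_Δ',
    WeierstrassCurve.coe_Δ', twistModel_c₄, twistModel_Δ]
  field_simp

/-- The twist model of the Tate form has the `j`-invariant of `E`. [folklore] -/
theorem j_twistModel_tateFormOfJ (W : WeierstrassCurve K) [W.IsElliptic]
    (hj : 1 < v.valuation K W.j) (k : K) [((tateFormOfJ W.j).twistModel k).IsElliptic] :
    ((tateFormOfJ W.j).twistModel k).j = W.j := by
  obtain ⟨hj0, hj1728, -⟩ := W.j_ne_and_valuation_j_sub_eq_of_one_lt_valuation_j v hj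
  haveI hT := isElliptic_tateFormOfJ hj0 hj1728
  rw [j_twistModel]
  exact tateFormOfJ_j hj0 hj1728

end Summit.ABC.ABC.Theorems.TamagawaTwistPayoffLine

end
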